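import Mathlib
import Literature.Analysis.ValidatedNumerics.TaylorModelIntegralCertTrig
import Literature.Analysis.ValidatedNumerics.TaylorModelExpr
import Summits.Ventures.FusionMHD.Models.CerfonFreidbergIterLikeQHalfResDefs
import Summits.Ventures.FusionMHD.Models.CerfonFreidbergIterLikeQHalfMercSound
import HarnessLib

/-!
# Ventures/FusionMHD — Models/CerfonFreidbergIterLikeQHalfResSound.lean: SOUNDNESS of the resistive-register obligation at `ψ_N = 1/2` of THE
# Cerfon–Freidberg ITER-like instance — what `CFIterLike.QHalfRes.ResCert.ok = true` MEANS

HONEST FRAMING (LADDER-GRIDFUSION three columns; CF rung; rider «D_R at ψ_N = 1/2» of «F2.R2-CF-MERCIER-IMPLICIT», step (3)).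
The 9-statement block `block3R` runs after `QHalfMerc.progM`; it reads `progM`'s registers `w = ((XD)²D)⁻¹` (depth 12), `X·m` (19), `G` (24), `D` (257), `X²` (371),
`X` (374), `m` (380).  §1 `b3b_extra` — the two INTERNAL registers of model-7's `b3b` that `block3R` reads (`w`, `X·m`), by symbolic execution of `b3b`;
`b3R_regs` — the two tops for ANY incoming stack described by hypotheses; §2 **`progR_regs`** — at THE instance the tops are
`g_AG = (G·m)·(X·(D²·w))·π` and `g_W = (X·m)·(X²·(D²·w))·π` along `mA` (the link file identifies them with `G s/(R D)` and `R s/D` where `X, D ≠ 0`);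
§3 **`sound_of_ok`** — the two `FSegOK` facts.  MODELLED: analytic Cerfon–Freidberg family; nothing about a device or stability.  No `decide`.
Typer/prover: gridfusion-model-7 (g7), 2026-08-28.  Citations: Zheng 2015 §3.2 (3.42) [Zheng2015]; Mahboubi–Melquiond–Sibut-Pinote 2016 §3.2 Lemma 3, §4.1
[MahboubiMelquiondSibutpinote2016].
-/

noncomputable section

open Set
open Literature.Analysis.ValidatedNumerics Literature.Analysis.ValidatedNumerics.PolyMP
open Literature.Analysis.ValidatedNumerics.NumericsMP Literature.Analysis.ValidatedNumerics.ExpPoly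
open Literature.MathematicalPhysics.MHD Literature.MathematicalPhysics.MHD.CerfonFreidberg

set_option autoImplicit false

namespace Summit.Ventures.FusionMHD.Models.CFIterLike.QHalfRes

set_option maxRecDepth 100000

/-! ## §1 Symbolic execution -/

/-- Length of `block3R`. -/
theorem block3R_length : CFIterLike.QHalfRes.block3R.length = 9 := by decide

/-- **The two internal registers of `b3b` read by `block3R`**: `w = ((X·D)·(X·D)·D)⁻¹` at depth 12 and `X·m` at depth 19 (same hypotheses as `b3b_regs`). -/
theorem b3b_extra (stk : List (ℝ → ℝ)) (Xa p : ℝ) (f0 FX FXX Fct FD FF2 FG : ℝ → ℝ)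
    (hG : getReg (fun _ => (0 : ℝ)) stk 0 = FG)
    (h2 : getReg (fun _ => (0 : ℝ)) stk 112 = fun _ => (2 : ℝ))
    (hF2 : getReg (fun _ => (0 : ℝ)) stk 113 = FF2)
    (hD : getReg (fun _ => (0 : ℝ)) stk 233 = FD)
    (hX : getReg (fun _ => (0 : ℝ)) stk 350 = FX)
    (hXX : getReg (fun _ => (0 : ℝ)) stk 347 = FXX)
    (hct : getReg (fun _ => (0 : ℝ)) stk 353 = Fct)
    (hm : getReg (fun _ => (0 : ℝ)) stk 356 = f0)
    (hXa : getReg (fun _ => (0 : ℝ)) stk 659 = fun _ => Xa)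
    (hp : getReg (fun _ => (0 : ℝ)) stk 661 = fun _ => p) :
    getReg (fun _ => (0 : ℝ)) (TProg.runF CFIterLike.QHalfMerc.b3b stk) 12 = (fun t => ((((FX t * FD t) * (FX t * FD t)) * FD t))⁻¹)
    ∧ getReg (fun _ => (0 : ℝ)) (TProg.runF CFIterLike.QHalfMerc.b3b stk) 19 = (fun t => (FX t * f0 t)) := by
  simp only [CFIterLike.QHalfMerc.b3b, TProg.runF, TOp.evalF, SOp.evalF, getReg_cons_zero, getReg_cons_succ, hG, h2, hF2, hD, hX, hXX, hct, hm, hXa, hp,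
    and_self]

/-- **`block3R`**: for any stack carrying `w` at depth 12, `X·m` at 19, `G` at 24, `D` at 257, `X²` at 371, `X` at 374, `m` at 380 and `p` at 685, the two tops
are the explicit products below. -/
theorem b3R_regs (stk : List (ℝ → ℝ)) (p : ℝ) (f0 FX FXX FD FG Fw FXm : ℝ → ℝ)
    (hw : getReg (fun _ => (0 : ℝ)) stk 12 = Fw)
    (hXm : getReg (fun _ => (0 : ℝ)) stk 19 = FXm)
    (hG : getReg (fun _ => (0 : ℝ)) stk 24 = FG)
    (hD : getReg (fun _ => (0 : ℝ)) stk 257 = FD)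
    (hXX : getReg (fun _ => (0 : ℝ)) stk 371 = FXX)
    (hX : getReg (fun _ => (0 : ℝ)) stk 374 = FX)
    (hm : getReg (fun _ => (0 : ℝ)) stk 380 = f0)
    (hp : getReg (fun _ => (0 : ℝ)) stk 685 = fun _ => p) :
    getReg (fun _ => (0 : ℝ)) (TProg.runF CFIterLike.QHalfRes.block3R stk) 0 = (fun t => (((FG t * f0 t) * (FX t * ((FD t * FD t) * Fw t))) * p))
    ∧ getReg (fun _ => (0 : ℝ)) (TProg.runF block3R stk) 1 = (fun t => ((FXm t * (FXX t * ((FD t * FD t) * Fw t))) * p)) := by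
  simp only [block3R, TProg.runF, TOp.evalF, SOp.evalF, getReg_cons_zero, getReg_cons_succ, hw, hXm, hG, hD, hXX, hX, hm, hp, and_self]

/-! ## §2 The two top registers at THE instance -/

/-- `w = ((X·D)·(X·D)·D)⁻¹` along the approximant. -/
def WinvA (t : ℝ) : ℝ := (((QHalfMerc.XA t * CFIterLike.QHalf.DrA t) * (QHalfMerc.XA t * CFIterLike.QHalf.DrA t)) * CFIterLike.QHalf.DrA t)⁻¹
/-- Register function of `g_AG` along the approximant (`(G·m)·(X·(D²·w))·π`). -/
def gAGA (t : ℝ) : ℝ := ((QHalfMerc.GA t * CFIterLike.QHalf.mA t) * (QHalfMerc.XA t * ((CFIterLike.QHalf.DrA t * CFIterLike.QHalf.DrA t) * WinvA t))) * Real.pi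
/-- Register function of `g_W` (`(X·m)·(X²·(D²·w))·π`). -/
def gWvA (t : ℝ) : ℝ := ((QHalfMerc.XA t * CFIterLike.QHalf.mA t) * ((QHalfMerc.XA t * QHalfMerc.XA t) * ((CFIterLike.QHalf.DrA t * CFIterLike.QHalf.DrA t) * WinvA t))) * Real.pi

/-- **THE TWO TOP REGISTERS OF `progR` AT THE INSTANCE** are `gAGA, gWvA`. -/
theorem progR_regs :
    getReg (fun _ => (0 : ℝ)) (TProg.runF CFIterLike.QHalfRes.progR (constStack CFIterLike.QHalf.params)) 0 = gAGA
    ∧ getReg (fun _ => (0 : ℝ)) (TProg.runF CFIterLike.QHalfRes.progR (constStack CFIterLike.QHalf.params)) 1 = gWvA := by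
  have hrun : TProg.runF progR (constStack CFIterLike.QHalf.params)
      = TProg.runF block3R (TProg.runF QHalfMerc.b3b (TProg.runF QHalfMerc.b3a (TProg.runF QHalfShear.block2 (TProg.runF QHalfShear.block1 CFIterLike.QHalf.stkA)))) := by
    rw [progR, QHalfMerc.progM, QHalfMerc.block3M_split, CFIterLike.QHalf.runF_append, CFIterLike.QHalf.runF_append, CFIterLike.QHalf.runF_append, CFIterLike.QHalf.runF_append, CFIterLike.QHalf.runF_append]; rfl
  have hP : ∀ i, getReg (fun _ => (0 : ℝ)) CFIterLike.QHalf.stkA (296 + i) = getReg (fun _ => (0 : ℝ)) (constStack CFIterLike.QHalf.params) i := CFIterLike.QHalf.stkA_param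
  have h1 := QHalfShear.block1_regs CFIterLike.QHalf.stkA coeff Xa (U Xa 0) Real.pi CFIterLike.QHalf.mA CFIterLike.QHalf.stkA_top
    (by rw [hP 0]; simp [constStack, CFIterLike.QHalf.params]) (by rw [hP 1]; simp [constStack, CFIterLike.QHalf.params]) (by rw [hP 2]; simp [constStack, CFIterLike.QHalf.params])
    (by rw [hP 3]; simp [constStack, CFIterLike.QHalf.params]) (by rw [hP 4]; simp [constStack, CFIterLike.QHalf.params]) (by rw [hP 5]; simp [constStack, CFIterLike.QHalf.params])
    (by rw [hP 6]; simp [constStack, CFIterLike.QHalf.params]) (by rw [hP 7]; simp [constStack, CFIterLike.QHalf.params]) (by rw [hP 8]; simp [constStack, CFIterLike.QHalf.params])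
    (by rw [hP 9]; simp [constStack, CFIterLike.QHalf.params])
  obtain ⟨hD, hX, hY, hL, hXX, hYY, hct, hst, hm, e306, e307, e311, e316, e331, e351, e357, e358, e373, e385, e397, e409⟩ := h1
  set stk1 := TProg.runF QHalfShear.block1 CFIterLike.QHalf.stkA with hstk1
  have hP1 : ∀ i, getReg (fun _ => (0 : ℝ)) stk1 (123 + i) = getReg (fun _ => (0 : ℝ)) CFIterLike.QHalf.stkA i := by
    intro i; rw [hstk1, ← QHalfShear.block_lengths.1]; exact CFIterLike.QHalf.getReg_runF_add _ QHalfShear.block1 _ i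
  have q : ∀ j : ℕ, getReg (fun _ => (0 : ℝ)) stk1 (123 + (296 + j)) = getReg (fun _ => (0 : ℝ)) (constStack CFIterLike.QHalf.params) j :=
    fun j => (hP1 (296 + j)).trans (hP j)
  have h2 := QHalfShear.block2_regs stk1 coeff Xa (U Xa 0) Real.pi CFIterLike.QHalf.mA hX hY hL hXX hYY hct hst e306 e307 e311 e316 e331 e351 e357 e358 e373 e385 e397 e409
    (by rw [show (419 : ℕ) = 123 + (296 + 0) by norm_num, q 0]; simp [constStack, CFIterLike.QHalf.params]) (by rw [show (420 : ℕ) = 123 + (296 + 1) by norm_num, q 1]; simp [constStack, CFIterLike.QHalf.params])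
    (by rw [show (421 : ℕ) = 123 + (296 + 2) by norm_num, q 2]; simp [constStack, CFIterLike.QHalf.params]) (by rw [show (422 : ℕ) = 123 + (296 + 3) by norm_num, q 3]; simp [constStack, CFIterLike.QHalf.params])
    (by rw [show (423 : ℕ) = 123 + (296 + 4) by norm_num, q 4]; simp [constStack, CFIterLike.QHalf.params]) (by rw [show (424 : ℕ) = 123 + (296 + 5) by norm_num, q 5]; simp [constStack, CFIterLike.QHalf.params])
    (by rw [show (425 : ℕ) = 123 + (296 + 6) by norm_num, q 6]; simp [constStack, CFIterLike.QHalf.params]) (by rw [show (426 : ℕ) = 123 + (296 + 7) by norm_num, q 7]; simp [constStack, CFIterLike.QHalf.params])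
    (by rw [show (427 : ℕ) = 123 + (296 + 8) by norm_num, q 8]; simp [constStack, CFIterLike.QHalf.params]) (by rw [show (428 : ℕ) = 123 + (296 + 9) by norm_num, q 9]; simp [constStack, CFIterLike.QHalf.params])
  set stk2 := TProg.runF QHalfShear.block2 stk1 with hstk2
  have hP2 : ∀ i, getReg (fun _ => (0 : ℝ)) stk2 (120 + i) = getReg (fun _ => (0 : ℝ)) stk1 i := by
    intro i; rw [hstk2, ← QHalfShear.block_lengths.2.1]; exact CFIterLike.QHalf.getReg_runF_add _ QHalfShear.block2 _ i
  have q2 : ∀ j : ℕ, getReg (fun _ => (0 : ℝ)) stk2 (120 + (123 + (296 + j))) = getReg (fun _ => (0 : ℝ)) (constStack CFIterLike.QHalf.params) j :=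
    fun j => (hP2 _).trans (q j)
  have h3 := QHalfMerc.b3a_regs stk2 coeff Xa Real.pi CFIterLike.QHalf.mA
    (by rw [show (237 : ℕ) = 120 + 117 by norm_num, hP2, hX]) (by rw [show (236 : ℕ) = 120 + 116 by norm_num, hP2, hY])
    (by rw [show (235 : ℕ) = 120 + 115 by norm_num, hP2, hL]) (by rw [show (234 : ℕ) = 120 + 114 by norm_num, hP2, hXX])
    (by rw [show (233 : ℕ) = 120 + 113 by norm_num, hP2, hYY])
    (by rw [show (540 : ℕ) = 120 + (123 + (296 + 1)) by norm_num, q2 1]; simp [constStack, CFIterLike.QHalf.params])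
    (by rw [show (541 : ℕ) = 120 + (123 + (296 + 2)) by norm_num, q2 2]; simp [constStack, CFIterLike.QHalf.params])
    (by rw [show (542 : ℕ) = 120 + (123 + (296 + 3)) by norm_num, q2 3]; simp [constStack, CFIterLike.QHalf.params])
    (by rw [show (543 : ℕ) = 120 + (123 + (296 + 4)) by norm_num, q2 4]; simp [constStack, CFIterLike.QHalf.params])
    (by rw [show (544 : ℕ) = 120 + (123 + (296 + 5)) by norm_num, q2 5]; simp [constStack, CFIterLike.QHalf.params])
    (by rw [show (545 : ℕ) = 120 + (123 + (296 + 6)) by norm_num, q2 6]; simp [constStack, CFIterLike.QHalf.params])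
  obtain ⟨hG, -, -, h2c⟩ := h3
  set stk3 := TProg.runF QHalfMerc.b3a stk2 with hstk3
  have hP3 : ∀ i, getReg (fun _ => (0 : ℝ)) stk3 (113 + i) = getReg (fun _ => (0 : ℝ)) stk2 i := by
    intro i; rw [hstk3, ← QHalfMerc.b3_lengths.1]; exact CFIterLike.QHalf.getReg_runF_add _ QHalfMerc.b3a _ i
  have q3 : ∀ j : ℕ, getReg (fun _ => (0 : ℝ)) stk3 (113 + (120 + (123 + (296 + j)))) = getReg (fun _ => (0 : ℝ)) (constStack CFIterLike.QHalf.params) j :=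
    fun j => (hP3 _).trans (q2 j)
  have h4 := QHalfMerc.b3b_regs stk3 Xa Real.pi CFIterLike.QHalf.mA QHalfMerc.XA (fun t => QHalfMerc.XA t * QHalfMerc.XA t) (fun t => Real.cos (Real.pi * t)) CFIterLike.QHalf.DrA QHalfMerc.F2A QHalfMerc.GA
    (by rw [hG]; funext t; simp only [QHalfMerc.GA, CFIterLike.QHalf.Gfield])
    (by rw [show (112 : ℕ) = 112 by rfl]; exact h2c)
    (by rw [show (113 : ℕ) = 113 + 0 by norm_num, hP3, h2]; funext t; simp only [QHalfMerc.F2A, CFIterLike.QHalf.F2field])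
    (by rw [show (233 : ℕ) = 113 + 120 by norm_num, hP3, show (120 : ℕ) = 120 + 0 by norm_num, hP2, hD]; funext t; simp only [CFIterLike.QHalf.DrA])
    (by rw [show (350 : ℕ) = 113 + (120 + 117) by norm_num, hP3, hP2, hX]; funext t; simp only [QHalfMerc.XA])
    (by rw [show (347 : ℕ) = 113 + (120 + 114) by norm_num, hP3, hP2, hXX]; funext t; simp only [QHalfMerc.XA])
    (by rw [show (353 : ℕ) = 113 + (120 + 120) by norm_num, hP3, hP2, hct])
    (by rw [show (356 : ℕ) = 113 + (120 + 123) by norm_num, hP3, hP2, hm])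
    (by rw [show (659 : ℕ) = 113 + (120 + (123 + (296 + 7))) by norm_num, q3 7]; simp [constStack, CFIterLike.QHalf.params])
    (by rw [show (661 : ℕ) = 113 + (120 + (123 + (296 + 9))) by norm_num, q3 9]; simp [constStack, CFIterLike.QHalf.params])
  obtain ⟨g0, g1, g2, g3⟩ := h4
  have hx := QHalfRes.b3b_extra stk3 Xa Real.pi CFIterLike.QHalf.mA QHalfMerc.XA (fun t => QHalfMerc.XA t * QHalfMerc.XA t) (fun t => Real.cos (Real.pi * t)) CFIterLike.QHalf.DrA QHalfMerc.F2A QHalfMerc.GA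
    (by rw [hG]; funext t; simp only [QHalfMerc.GA, CFIterLike.QHalf.Gfield])
    (by rw [show (112 : ℕ) = 112 by rfl]; exact h2c)
    (by rw [show (113 : ℕ) = 113 + 0 by norm_num, hP3, h2]; funext t; simp only [QHalfMerc.F2A, CFIterLike.QHalf.F2field])
    (by rw [show (233 : ℕ) = 113 + 120 by norm_num, hP3, show (120 : ℕ) = 120 + 0 by norm_num, hP2, hD]; funext t; simp only [CFIterLike.QHalf.DrA])
    (by rw [show (350 : ℕ) = 113 + (120 + 117) by norm_num, hP3, hP2, hX]; funext t; simp only [QHalfMerc.XA])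
    (by rw [show (347 : ℕ) = 113 + (120 + 114) by norm_num, hP3, hP2, hXX]; funext t; simp only [QHalfMerc.XA])
    (by rw [show (353 : ℕ) = 113 + (120 + 120) by norm_num, hP3, hP2, hct])
    (by rw [show (356 : ℕ) = 113 + (120 + 123) by norm_num, hP3, hP2, hm])
    (by rw [show (659 : ℕ) = 113 + (120 + (123 + (296 + 7))) by norm_num, q3 7]; simp [constStack, CFIterLike.QHalf.params])
    (by rw [show (661 : ℕ) = 113 + (120 + (123 + (296 + 9))) by norm_num, q3 9]; simp [constStack, CFIterLike.QHalf.params])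
  obtain ⟨hw4, hXm4⟩ := hx
  set stk4 := TProg.runF QHalfMerc.b3b stk3 with hstk4
  have hP4 : ∀ i, getReg (fun _ => (0 : ℝ)) stk4 (24 + i) = getReg (fun _ => (0 : ℝ)) stk3 i := by
    intro i; rw [hstk4, ← QHalfMerc.b3_lengths.2]; exact CFIterLike.QHalf.getReg_runF_add _ QHalfMerc.b3b _ i
  have h5 := b3R_regs stk4 Real.pi CFIterLike.QHalf.mA QHalfMerc.XA (fun t => QHalfMerc.XA t * QHalfMerc.XA t) CFIterLike.QHalf.DrA QHalfMerc.GA WinvA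
    (fun t => QHalfMerc.XA t * CFIterLike.QHalf.mA t)
    (by rw [hw4]; funext t; simp only [WinvA])
    (by rw [hXm4])
    (by rw [show (24 : ℕ) = 24 + 0 by norm_num, hP4, hG]; funext t; simp only [QHalfMerc.GA, CFIterLike.QHalf.Gfield])
    (by rw [show (257 : ℕ) = 24 + (113 + 120) by norm_num, hP4, hP3, show (120 : ℕ) = 120 + 0 by norm_num, hP2, hD]; funext t; simp only [CFIterLike.QHalf.DrA])
    (by rw [show (371 : ℕ) = 24 + (113 + (120 + 114)) by norm_num, hP4, hP3, hP2, hXX]; funext t; simp only [QHalfMerc.XA])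
    (by rw [show (374 : ℕ) = 24 + (113 + (120 + 117)) by norm_num, hP4, hP3, hP2, hX]; funext t; simp only [QHalfMerc.XA])
    (by rw [show (380 : ℕ) = 24 + (113 + (120 + 123)) by norm_num, hP4, hP3, hP2, hm])
    (by rw [show (685 : ℕ) = 24 + (113 + (120 + (123 + (296 + 9)))) by norm_num, hP4, q3 9]; simp [constStack, CFIterLike.QHalf.params])
  rw [hrun]
  obtain ⟨r0, r1⟩ := h5
  refine ⟨?_, ?_⟩
  · rw [r0]; funext t; simp only [gAGA]
  · rw [r1]; funext t; simp only [gWvA]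

/-! ## §3 Soundness of the per-panel obligation -/

/-- **SOUNDNESS OF `ResCert.ok`**: the integral segments of `gAGA` and `gWvA` hold with the claimed bounds on panel `d.j`. -/
theorem sound_of_ok {d : CFIterLike.QHalfRes.ResCert} (h : d.ok = true) :
    FSegOK gAGA [1] CFIterLike.QHalf.tmS (panelLeft CFIterLike.QHalf.hw d.j) (panelLeft CFIterLike.QHalf.hw (d.j + 1)) d.glo d.ghi
    ∧ FSegOK gWvA [1] CFIterLike.QHalf.tmS (panelLeft CFIterLike.QHalf.hw d.j) (panelLeft CFIterLike.QHalf.hw (d.j + 1)) d.wlo d.whi := by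
  simp only [ResCert.ok, QHalfMerc.integ, Bool.and_eq_true, decide_eq_true_eq] at h
  obtain ⟨⟨⟨⟨hok, hglo⟩, hghi⟩, hwlo⟩, hwhi⟩ := h
  unfold panelModels at hok hglo hghi hwlo hwhi
  have hst := TProg.stackMem_model CFIterLike.QHalf.tmS_pos CFIterLike.QHalf.hw_pos.le (CFIterLike.QHalf.ctr d.j) progR (stackMem_const CFIterLike.QHalf.tmS CFIterLike.QHalf.hw (CFIterLike.QHalf.ctr d.j) CFIterLike.QHalf.boxMem_params) _ hok
  have hmeas : ∀ i, Measurable (getReg (fun _ => (0 : ℝ)) (TProg.runF progR (constStack CFIterLike.QHalf.params)) i) :=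
    QHalfMerc.measurable_runF' progR _ (QHalfMerc.measurable_constStack' CFIterLike.QHalf.params)
  obtain ⟨g0, g1⟩ := progR_regs
  have hW0 := hst 0; have hW1 := hst 1
  have hm0 := hmeas 0; have hm1 := hmeas 1
  rw [g0] at hW0 hm0; rw [g1] at hW1 hm1
  rw [← CFIterLike.QHalf.pc_eq] at hW0 hW1 hglo hghi hwlo hwhi
  exact ⟨fsegOK_of_tmem CFIterLike.QHalf.tmS_pos CFIterLike.QHalf.hw_pos hm0 [1] d.j hW0 hglo hghi, fsegOK_of_tmem CFIterLike.QHalf.tmS_pos CFIterLike.QHalf.hw_pos hm1 [1] d.j hW1 hwlo hwhi⟩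

end Summit.Ventures.FusionMHD.Models.CFIterLike.QHalfRes

end
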